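import Mathlib.Algebra.MvPolynomial.Equiv
import Mathlib.Algebra.Polynomial.Derivative
import Mathlib.Analysis.Calculus.ImplicitContDiff
import Mathlib.Analysis.Calculus.Deriv.Polynomial
import Mathlib.Analysis.Calculus.Deriv.Prod
import Mathlib.Analysis.Polynomial.CauchyBound
import Mathlib.Topology.MetricSpace.Sequences
import Mathlib.Order.Filter.AtTopBot.CountablyGenerated
import Literature.NumberTheory.Transcendental.SemialgebraicMaps
import Literature.NumberTheory.Transcendental.SemialgebraicMapsProofs
import Literature.ModelTheory.ExponentialFields.TarskiSeidenbergProofs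
import Literature.ModelTheory.ExponentialFields.ThomLemma
import Literature.ModelTheory.ExponentialFields.SemialgebraicInterior
import HarnessLib

/-!
# Semialgebraic functions are smooth off a small semialgebraic set (proof file)

Discharge of the named fact
`Literature.NumberTheory.Transcendental.IsSemialgebraicFunOn.exists_contDiffOn` of
`Literature/NumberTheory/Transcendental/SemialgebraicMaps.lean`: a real function `f` whose graph
over `s ⊆ ℝ ^ m` is `k`-semialgebraic is `C^∞` off a `k`-semialgebraic subset `Z ⊆ s` with empty
interior and `s \ Z` open (Bochnak–Coste–Roy 1998, §2.9: semialgebraic functions are Nash on the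
open strata of a stratification; van den Dries 1998, Ch. 7 (3.2): definable functions are `C¹` off a
nowhere dense set). The theorem `IsSemialgebraicFunOn.exists_contDiffOn_holds` at the end has
literally the type `IsSemialgebraicFunOn.exists_contDiffOn`.

## Proof architecture (direct, without cell decomposition)

1. *An algebraic relation.* Writing the graph `Γ = {(f x, x) | x ∈ s} ⊆ ℝ ^ (1 + m)` by sign
   conditions on a finite family `Q` of polynomials over `k`
   (`IsSemialgebraic.exists_eq_setOf_signVec_mem`), every point of `Γ` is a zero of a member of `Q`
   that does not vanish identically, because `Γ`, a graph, has empty interior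
   (`IsSemialgebraic.subset_interior_union` of `SemialgebraicInterior.lean`;
   `exists_finset_forall_exists_aeval_cons_eq_zero` below): locally on `s`, a semialgebraic
   function satisfies a non-trivial polynomial identity `q(f x, x) = 0`.
2. *Pieces.* For `q ∈ Q`, a degree `e` and a sign vector `τ` on the `y`-derivatives
   `∂ʲq/∂yʲ, j ≤ N`, the piece `M(q, e, τ) ⊆ s` is where `q(x, ·)` has degree exactly `e` and
   `sign ∂ʲq/∂yʲ (x, f x) = τ j` for all `j`; it is semialgebraic by graph elimination
   (`IsSemialgebraicFunOn.isSemialgebraic_sep_snoc_mem`, Tarski–Seidenberg). With `τ 0 = 0`,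
   `f x` is the root of `q(x, ·)` singled out by the Thom sign condition `τ`.
3. *Continuity on the interior of a piece* (`continuousAt_of_thom_signs`): along `xₙ → x₀` the
   values `f xₙ` are bounded (Cauchy bound, the leading coefficient staying away from `0`), and any
   limit point lies in the relaxed Thom cell of `q(x₀, ·)`, which is the single point `{f x₀}` by
   Thom's lemma (`Thom.eq_singleton_of_mem`, `ThomLemma.lean`).
4. *Smoothness on the interior of a piece* (`contDiffAt_of_simple_root`): with
   `r = min {j ≥ 1 | τ j ≠ 0}`, `f x` is a simple root of `∂ʳ⁻¹q/∂yʳ⁻¹ (x, ·)`, and a continuous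
   function which is pointwise a simple root of a smooth equation is smooth (implicit function
   theorem with smoothness, Mathlib's `ContDiffAt.implicitFunction`).
5. *The exceptional set* `Z = s \ ⋃ interior M(q, e, τ)` is semialgebraic (interior of a
   semialgebraic set is semialgebraic, `isSemialgebraic_interior`) and has empty interior: it is
   covered by the sets `{x | q(x, ·) = 0}` (`q` not identically zero: a proper algebraic subset) and
   `M \ interior M` (semialgebraic with empty interior, hence nowhere dense,
   `IsSemialgebraic.interior_closure_eq_empty`), finitely many closed sets with empty interior.

## References

* J. Bochnak, M. Coste, M.-F. Roy, *Real Algebraic Geometry*, Ergebnisse 36, Springer (1998),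
  §2.5 (Thom's lemma, Prop. 2.5.4), §2.9 (Nash functions; Prop. 2.9.10), Thm. 9.1.8.
* S. Basu, R. Pollack, M.-F. Roy, *Algorithms in Real Algebraic Geometry*, 2nd ed., Springer
  (2006), Lemma 5.33 (Thom's lemma), Thm. 3.25 (implicit function theorem), Prop. 5.20
  (piecewise continuity of semi-algebraic functions), Remark 5.35 (cell functions are simple roots
  of a derivative).
* L. van den Dries, *Tame topology and o-minimal structures*, LMS LN 248 (1998), Ch. 7 (3.2).

## Design notes

* No new definitions; the univariate specialisation `q(x, ·) ∈ ℝ[Y]` of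
  `q ∈ k[Y, X₁, …, Xₘ]` is `((finSuccEquiv k m q).map (eval₂Hom (algebraMap k ℝ) x))`, the variable
  `0` playing the role of `y` (coordinates `Fin.cons y x`, cf.
  `Literature.ModelTheory.ExponentialFields.eval_map_finSuccEquiv`), and its `y`-derivatives are the
  polynomials `(finSuccEquiv k m).symm (derivative^[j] (finSuccEquiv k m q))` over `k`.
* The hypothesis `IsOpen s` of the fact is not needed by this proof (the set `s \ Z` produced is a
  union of interiors).
-/

noncomputable section

open Set Filter MvPolynomial Polynomial
open _root_.Topology
open scoped ContDiff

namespace Literature.NumberTheory.Transcendental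

variable {k : Type*} [CommRing k] [Algebra k ℝ] {m : ℕ}

/-! ### Specialisation of a polynomial over `k` in its first variable -/

section Specialisation

/-- The `y`-derivatives of `q ∈ k[Y, X₁, …, Xₘ]`, as polynomials over `k`, evaluate at `(y, x)` to
the derivatives of the specialisation `q(x, ·) ∈ ℝ[Y]` at `y`. [folklore] -/
theorem aeval_cons_symm_iterate_derivative (q : MvPolynomial (Fin (m + 1)) k) (j : ℕ)
    (x : Fin m → ℝ) (y : ℝ) :
    aeval (Fin.cons y x : Fin (m + 1) → ℝ)
        ((finSuccEquiv k m).symm (derivative^[j] (finSuccEquiv k m q))) =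
      (derivative^[j] ((finSuccEquiv k m q).map (MvPolynomial.eval₂Hom (algebraMap k ℝ) x))).eval
        y := by
  rw [← Literature.ModelTheory.ExponentialFields.eval_map_finSuccEquiv x y,
    AlgEquiv.apply_symm_apply, ← Polynomial.iterate_derivative_map]

/-- Case `j = 0` of `aeval_cons_symm_iterate_derivative`: `q(y, x) = q(x, ·)(y)`. [folklore] -/
theorem aeval_cons_eq_eval_map (q : MvPolynomial (Fin (m + 1)) k) (x : Fin m → ℝ) (y : ℝ) :
    aeval (Fin.cons y x : Fin (m + 1) → ℝ) q =
      ((finSuccEquiv k m q).map (MvPolynomial.eval₂Hom (algebraMap k ℝ) x)).eval y :=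
  (Literature.ModelTheory.ExponentialFields.eval_map_finSuccEquiv x y q).symm

/-- The coefficients of the specialisation `q(x, ·)` are the values at `x` of the coefficients of
`q` viewed in `k[X₁, …, Xₘ][Y]`. [folklore] -/
theorem coeff_map_finSuccEquiv (q : MvPolynomial (Fin (m + 1)) k) (x : Fin m → ℝ) (i : ℕ) :
    ((finSuccEquiv k m q).map (MvPolynomial.eval₂Hom (algebraMap k ℝ) x)).coeff i =
      aeval x ((finSuccEquiv k m q).coeff i) := by
  rw [Polynomial.coeff_map, MvPolynomial.aeval_eq_eval₂Hom]

/-- The specialisation `q(x, ·)` vanishes iff all the coefficients of `q` (in `k[X][Y]`, up to the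
degree of `q` in `Y`) vanish at `x`. [folklore] -/
theorem map_finSuccEquiv_eq_zero_iff (q : MvPolynomial (Fin (m + 1)) k) (x : Fin m → ℝ) {N : ℕ}
    (hN : (finSuccEquiv k m q).natDegree ≤ N) :
    (finSuccEquiv k m q).map (MvPolynomial.eval₂Hom (algebraMap k ℝ) x) = 0 ↔
      ∀ i ≤ N, aeval x ((finSuccEquiv k m q).coeff i) = 0 := by
  rw [Polynomial.ext_iff]
  constructor
  · intro h i _
    rw [← coeff_map_finSuccEquiv, h i, Polynomial.coeff_zero]
  · intro h i
    rw [Polynomial.coeff_zero, coeff_map_finSuccEquiv]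
    by_cases hi : i ≤ N
    · exact h i hi
    · rw [Polynomial.coeff_eq_zero_of_natDegree_lt (hN.trans_lt (not_le.mp hi)), map_zero]

/-- The map `(x, y) ↦ (y, x) : ℝ ^ m × ℝ → ℝ ^ (1 + m)` (`Fin.cons`) is smooth. [folklore] -/
theorem contDiff_cons : ContDiff ℝ ∞ fun z : (Fin m → ℝ) × ℝ => (Fin.cons z.2 z.1 : Fin (m + 1) → ℝ) := by
  refine contDiff_pi.mpr fun i => ?_
  refine Fin.cases ?_ (fun j => ?_) i
  · simpa using contDiff_snd
  · have h := (contDiff_apply (n := ∞) ℝ ℝ j).comp (contDiff_fst (𝕜 := ℝ) (E := Fin m → ℝ) (F := ℝ))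
    simp only [Fin.cons_succ]
    exact h

/-- Polynomial functions on `ℝ ^ (1 + m)` composed with `(x, y) ↦ (y, x)` are smooth. [folklore] -/
theorem contDiff_aeval_cons (Q : MvPolynomial (Fin (m + 1)) k) :
    ContDiff ℝ ∞ fun z : (Fin m → ℝ) × ℝ => aeval (Fin.cons z.2 z.1 : Fin (m + 1) → ℝ) Q :=
  ((Literature.ModelTheory.ExponentialFields.analyticOnNhd_aeval Q).contDiff).comp contDiff_cons

/-- The derivatives of the specialisations, `(x, y) ↦ (∂ʲq(x, ·))(y)`, are jointly continuous.
[folklore] -/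
theorem continuous_eval_iterate_derivative_map (q : MvPolynomial (Fin (m + 1)) k) (j : ℕ) :
    Continuous fun z : (Fin m → ℝ) × ℝ =>
      (derivative^[j] ((finSuccEquiv k m q).map (MvPolynomial.eval₂Hom (algebraMap k ℝ) z.1))).eval
        z.2 := by
  have := (contDiff_aeval_cons ((finSuccEquiv k m).symm (derivative^[j] (finSuccEquiv k m q)))).continuous
  simpa only [aeval_cons_symm_iterate_derivative] using this

/-- The coefficients of the specialisations, `x ↦ coeffᵢ q(x, ·)`, are continuous. [folklore] -/
theorem continuous_coeff_map_finSuccEquiv (q : MvPolynomial (Fin (m + 1)) k) (i : ℕ) :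
    Continuous fun x : Fin m → ℝ =>
      ((finSuccEquiv k m q).map (MvPolynomial.eval₂Hom (algebraMap k ℝ) x)).coeff i := by
  simpa only [coeff_map_finSuccEquiv] using
    Literature.ModelTheory.ExponentialFields.continuous_aeval_real ((finSuccEquiv k m q).coeff i)

end Specialisation

/-! ### Continuity of a root selected by a Thom sign condition -/

section Continuity

/-- Cauchy's bound in sum form: a root `y` of a real polynomial `p ≠ 0` of degree `e` satisfies
`|y| < (∑_{i<e} |pᵢ|) / |pₑ| + 1`. [folklore] -/
theorem abs_lt_of_isRoot {p : ℝ[X]} {e : ℕ} (he : p.natDegree = e) (hp : p ≠ 0) {y : ℝ}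
    (hy : p.IsRoot y) : |y| < (∑ i ∈ Finset.range e, |p.coeff i|) / |p.coeff e| + 1 := by
  have h : (‖y‖₊ : ℝ) < (cauchyBound p : ℝ) := NNReal.coe_lt_coe.mpr (hy.norm_lt_cauchyBound hp)
  rw [coe_nnnorm, Real.norm_eq_abs] at h
  refine h.trans_le ?_
  have hsup : ((Finset.range e).sup fun i => ‖p.coeff i‖₊) ≤ ∑ i ∈ Finset.range e, ‖p.coeff i‖₊ :=
    Finset.sup_le fun i hi => Finset.single_le_sum (f := fun i => ‖p.coeff i‖₊) (fun j _ => zero_le) hi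
  have hsup' : (((Finset.range e).sup fun i => ‖p.coeff i‖₊ : NNReal) : ℝ) ≤
      ∑ i ∈ Finset.range e, |p.coeff i| := by
    refine (NNReal.coe_le_coe.mpr hsup).trans_eq ?_
    rw [NNReal.coe_sum]
    simp
  rw [cauchyBound, Polynomial.leadingCoeff, he, NNReal.coe_add, NNReal.coe_div, NNReal.coe_one,
    coe_nnnorm, Real.norm_eq_abs]
  exact add_le_add (div_le_div_of_nonneg_right hsup' (abs_nonneg _)) le_rfl

/-- **Continuity of a Thom-selected root.** Let `P x ∈ ℝ[Y]` depend on `x ∈ ℝ ^ m` with jointly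
continuous derivatives `(x, y) ↦ (∂ʲP x)(y)` and continuous coefficients, and let `U` be an open set
on which `P x ≠ 0` has constant degree `e` and the signs of all `(∂ʲP x)(f x)`, `j ≤ e`, are a fixed
vector `σ` with `σ 0 = 0` (so `f x` is a root of `P x`). Then `f` is continuous on `U`: along
`xₙ → x₀` the roots `f xₙ` stay bounded (Cauchy bound) and every limit point lies in the relaxed
Thom cell of `P x₀` for `σ`, which is `{f x₀}` by Thom's lemma.
[cite: BasuPollackRoy2006, Lemma 5.33 (Thom's lemma)] -/
theorem continuousAt_of_thom_signs {U : Set (Fin m → ℝ)} (hU : IsOpen U) {f : (Fin m → ℝ) → ℝ}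
    (P : (Fin m → ℝ) → ℝ[X])
    (hPc : ∀ j : ℕ, Continuous fun z : (Fin m → ℝ) × ℝ => (derivative^[j] (P z.1)).eval z.2)
    (hcoef : ∀ i : ℕ, Continuous fun x => (P x).coeff i)
    {e : ℕ} (he : ∀ x ∈ U, (P x).natDegree = e) (hP0 : ∀ x ∈ U, P x ≠ 0)
    {σ : ℕ → SignType} (hσ : σ 0 = 0)
    (hsign : ∀ x ∈ U, ∀ j ≤ e, SignType.sign ((derivative^[j] (P x)).eval (f x)) = σ j)
    {x₀ : Fin m → ℝ} (hx₀ : x₀ ∈ U) : ContinuousAt f x₀ := by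
  -- `f x` is a root of `P x` on `U`
  have hroot : ∀ x ∈ U, (P x).IsRoot (f x) := fun x hx => by
    have := hsign x hx 0 (Nat.zero_le _)
    rw [hσ, sign_eq_zero_iff] at this
    simpa using this
  -- a bound for the roots, continuous at `x₀`
  set B : (Fin m → ℝ) → ℝ := fun x =>
    (∑ i ∈ Finset.range e, |(P x).coeff i|) / |(P x).coeff e| + 1 with hB
  have hlc : (P x₀).coeff e ≠ 0 := by
    rw [← he x₀ hx₀]
    exact leadingCoeff_ne_zero.mpr (hP0 x₀ hx₀)
  have hBc : ContinuousAt B x₀ := by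
    refine ContinuousAt.add (ContinuousAt.div ?_ (hcoef e).abs.continuousAt (abs_ne_zero.mpr hlc))
      continuousAt_const
    exact (continuous_finsetSum _ fun i _ => (hcoef i).abs).continuousAt
  have hbd : ∀ x ∈ U, |f x| < B x := fun x hx =>
    abs_lt_of_isRoot (he x hx) (hP0 x hx) (hroot x hx)
  have hev : ∀ᶠ x in 𝓝 x₀, x ∈ U ∧ |f x| < B x₀ + 1 := by
    filter_upwards [hU.mem_nhds hx₀, hBc.eventually_lt continuousAt_const (lt_add_one (B x₀))]
      with x hx hx'
    exact ⟨hx, (hbd x hx).trans hx'⟩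
  -- Thom's lemma at `x₀`: the relaxed cell is `{f x₀}`
  have hthom := (Literature.ModelTheory.ExponentialFields.Thom.eq_singleton_of_mem (hP0 x₀ hx₀) hσ
    (y₀ := f x₀) (fun j hj => hsign x₀ hx₀ j ((he x₀ hx₀) ▸ hj))).2
  -- sequential argument
  change Tendsto f (𝓝 x₀) (𝓝 (f x₀))
  refine tendsto_of_subseq_tendsto fun ns hns => ?_
  obtain ⟨N₀, hN₀⟩ := eventually_atTop.mp (hns.eventually hev)
  have hmem : ∀ n, f (ns (n + N₀)) ∈ Icc (-(B x₀ + 1)) (B x₀ + 1) := fun n => by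
    have := (hN₀ (n + N₀) (Nat.le_add_left _ _)).2
    exact ⟨(abs_lt.mp this).1.le, (abs_lt.mp this).2.le⟩
  obtain ⟨a, -, φ, hφ, hlim⟩ := tendsto_subseq_of_bounded (Metric.isBounded_Icc _ _) hmem
  have hxlim : Tendsto (fun n => ns (φ n + N₀)) atTop (𝓝 x₀) :=
    hns.comp ((tendsto_add_atTop_nat N₀).comp hφ.tendsto_atTop)
  have hlim' : Tendsto (fun n => f (ns (φ n + N₀))) atTop (𝓝 a) := hlim
  -- the limit `a` lies in the relaxed Thom cell of `P x₀`, hence `a = f x₀`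
  have ha : a = f x₀ := by
    have hrel : a ∈ {y | ∀ j ≤ (P x₀).natDegree,
        SignType.sign ((derivative^[j] (P x₀)).eval y) = σ j ∨
          (derivative^[j] (P x₀)).eval y = 0} := by
      intro j hj
      rw [he x₀ hx₀] at hj
      have hL : Tendsto (fun n => (derivative^[j] (P (ns (φ n + N₀)))).eval (f (ns (φ n + N₀))))
          atTop (𝓝 ((derivative^[j] (P x₀)).eval a)) :=
        ((hPc j).tendsto (x₀, a)).comp (hxlim.prodMk_nhds hlim')
      have hsn : ∀ n, SignType.sign ((derivative^[j] (P (ns (φ n + N₀)))).eval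
          (f (ns (φ n + N₀)))) = σ j :=
        fun n => hsign _ (hN₀ (φ n + N₀) (Nat.le_add_left _ _)).1 j hj
      rcases Literature.ModelTheory.ExponentialFields.Thom.signType_cases (σ j) with h | h | h
      · right
        have hz : (fun n => (derivative^[j] (P (ns (φ n + N₀)))).eval (f (ns (φ n + N₀)))) =
            fun _ => 0 := by
          funext n
          have := hsn n
          rw [h, sign_eq_zero_iff] at this
          exact this
        rw [hz] at hL
        exact (tendsto_nhds_unique tendsto_const_nhds hL).symm
      · have hle : (derivative^[j] (P x₀)).eval a ≤ 0 :=
          le_of_tendsto' hL fun n => by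
            have := hsn n
            rw [h, sign_eq_neg_one_iff] at this
            exact this.le
        rcases hle.lt_or_eq with hlt | heq
        · left
          rw [h]
          exact sign_neg hlt
        · exact Or.inr heq
      · have hge : 0 ≤ (derivative^[j] (P x₀)).eval a :=
          ge_of_tendsto' hL fun n => by
            have := hsn n
            rw [h, sign_eq_one_iff] at this
            exact this.le
        rcases hge.lt_or_eq with hlt | heq
        · left
          rw [h]
          exact sign_pos hlt
        · exact Or.inr heq.symm
    rw [hthom] at hrel
    exact hrel
  exact ⟨fun n => φ n + N₀, ha ▸ hlim'⟩

end Continuity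

/-! ### Smoothness of a continuous simple root (implicit function theorem) -/

section Implicit

/-- **A continuous simple root of a smooth equation is smooth.** If `F : ℝ ^ m × ℝ → ℝ` is `C^∞`,
`U` is open, `f` is continuous on `U` and for every `x ∈ U` the value `f x` is a simple zero of
`F (x, ·)`, then `f` is `C^∞` at every point of `U`: by the implicit function theorem the zeros of
`F` near `(x₀, f x₀)` form the graph of a `C^∞` function `ψ`, and `f = ψ` near `x₀` by continuity.
[cite: BasuPollackRoy2006, Thm. 3.25 (implicit function theorem)] -/
theorem contDiffAt_of_simple_root {U : Set (Fin m → ℝ)} (hU : IsOpen U) {f : (Fin m → ℝ) → ℝ}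
    (F : (Fin m → ℝ) × ℝ → ℝ) (hF : ContDiff ℝ ∞ F)
    (hroot : ∀ x ∈ U, F (x, f x) = 0)
    (hder : ∀ x ∈ U, deriv (fun y => F (x, y)) (f x) ≠ 0)
    (hcont : ∀ x ∈ U, ContinuousAt f x) {x₀ : Fin m → ℝ} (hx₀ : x₀ ∈ U) :
    ContDiffAt ℝ ∞ f x₀ := by
  have cdf : ContDiffAt ℝ ∞ F (x₀, f x₀) := hF.contDiffAt
  have pn : (∞ : ℕ∞ω) ≠ 0 := by simp
  -- the partial derivative in `y` at `(x₀, f x₀)` is `deriv (F (x₀, ·)) (f x₀) ≠ 0`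
  set c : ℝ := fderiv ℝ F (x₀, f x₀) ((0 : Fin m → ℝ), (1 : ℝ)) with hc
  have hcd : deriv (fun y => F (x₀, y)) (f x₀) = c := by
    have h1 : HasFDerivAt F (fderiv ℝ F (x₀, f x₀)) (x₀, f x₀) :=
      (cdf.differentiableAt pn).hasFDerivAt
    have h2 : HasDerivAt (fun y : ℝ => ((x₀, y) : (Fin m → ℝ) × ℝ)) ((0 : Fin m → ℝ), (1 : ℝ))
        (f x₀) :=
      (hasDerivAt_const (f x₀) x₀).prodMk (hasDerivAt_id (f x₀))
    exact (h1.comp_hasDerivAt (f x₀) h2).deriv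
  have hc0 : c ≠ 0 := hcd ▸ hder x₀ hx₀
  have if₂ : (fderiv ℝ F (x₀, f x₀) ∘L ContinuousLinearMap.inr ℝ (Fin m → ℝ) ℝ).IsInvertible := by
    refine ContinuousLinearMap.IsInvertible.of_inverse (g := c⁻¹ • ContinuousLinearMap.id ℝ ℝ)
      ?_ ?_
    · apply ContinuousLinearMap.ext_ring
      have hsm : (((0 : Fin m → ℝ), c⁻¹) : (Fin m → ℝ) × ℝ) = c⁻¹ • ((0 : Fin m → ℝ), (1 : ℝ)) := by
        simp
      simp only [ContinuousLinearMap.comp_apply, smul_apply,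
        ContinuousLinearMap.id_apply, smul_eq_mul, mul_one, ContinuousLinearMap.inr_apply]
      rw [hsm, ContinuousLinearMap.map_smul, smul_eq_mul, ← hc, inv_mul_cancel₀ hc0]
    · apply ContinuousLinearMap.ext_ring
      simp only [ContinuousLinearMap.comp_apply, smul_apply,
        ContinuousLinearMap.id_apply, smul_eq_mul, ContinuousLinearMap.inr_apply]
      rw [← hc, inv_mul_cancel₀ hc0]
  have hev := cdf.eventually_apply_eq_iff_implicitFunction pn if₂
  have hψ := cdf.contDiffAt_implicitFunction pn if₂
  -- `f` agrees with the implicit function near `x₀`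
  have hγ : Tendsto (fun x => (x, f x)) (𝓝 x₀) (𝓝 (x₀, f x₀)) :=
    continuousAt_id.prodMk (hcont x₀ hx₀)
  have heq : f =ᶠ[𝓝 x₀] cdf.implicitFunction pn if₂ := by
    filter_upwards [hγ.eventually hev, hU.mem_nhds hx₀] with x hx hxU
    have h0 : F (x, f x) = F (x₀, f x₀) := by rw [hroot x hxU, hroot x₀ hx₀]
    exact (hx.mp h0).symm
  exact hψ.congr_of_eventuallyEq heq

/-- The derivative in `y` of `(x, y) ↦ q(y, x)` is the value of the `y`-derivative of the
specialisation `q(x, ·)`. [folklore] -/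
theorem deriv_aeval_cons (Q : MvPolynomial (Fin (m + 1)) k) (x : Fin m → ℝ) (y : ℝ) :
    deriv (fun t : ℝ => aeval (Fin.cons t x : Fin (m + 1) → ℝ) Q) y =
      (derivative ((finSuccEquiv k m Q).map (MvPolynomial.eval₂Hom (algebraMap k ℝ) x))).eval
        y := by
  simp only [aeval_cons_eq_eval_map]
  exact Polynomial.deriv _

/-- The `y`-derivative of `(x, t) ↦ (∂ʲq(x, ·))(t)` at `y` is `(∂ʲ⁺¹q(x, ·))(y)`. [folklore] -/
theorem deriv_aeval_cons_symm_iterate_derivative (q : MvPolynomial (Fin (m + 1)) k) (j : ℕ)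
    (x : Fin m → ℝ) (y : ℝ) :
    deriv (fun t : ℝ => aeval (Fin.cons t x : Fin (m + 1) → ℝ)
        ((finSuccEquiv k m).symm (derivative^[j] (finSuccEquiv k m q)))) y =
      (derivative^[j + 1] ((finSuccEquiv k m q).map (MvPolynomial.eval₂Hom (algebraMap k ℝ) x))).eval
        y := by
  simp only [aeval_cons_symm_iterate_derivative, Function.iterate_succ_apply']
  exact Polynomial.deriv _

/-- The top derivative of a polynomial of degree `e` is the constant `e! · pₑ`. [folklore] -/
theorem eval_iterate_derivative_natDegree {p : ℝ[X]} {e : ℕ} (he : p.natDegree = e) (y : ℝ) :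
    (derivative^[e] p).eval y = (e.factorial : ℝ) * p.coeff e := by
  have hdeg : (derivative^[e] p).natDegree ≤ 0 := by
    have := natDegree_iterate_derivative p e
    rw [he, Nat.sub_self] at this
    exact this
  rw [eq_C_of_natDegree_le_zero hdeg, Polynomial.eval_C, coeff_iterate_derivative, zero_add,
    Nat.descFactorial_self, nsmul_eq_mul]

end Implicit

/-! ### The graph in `cons` coordinates and the algebraic relation -/

section Graph

variable {s : Set (Fin m → ℝ)} {f : (Fin m → ℝ) → ℝ}

/-- The graph `{(f x, x) | x ∈ s} ⊆ ℝ ^ (1 + m)` of a semialgebraic function, in `Fin.cons`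
coordinates, is semialgebraic (a coordinate permutation of the `Fin.snoc` graph).
[cite: BochnakCosteRoy1998, Def. 2.2.5] -/
theorem IsSemialgebraicFunOn.isSemialgebraic_setOf_cons (hf : IsSemialgebraicFunOn k s f) :
    Literature.ModelTheory.ExponentialFields.IsSemialgebraic k
      {z : Fin (m + 1) → ℝ | ∃ x ∈ s, z = Fin.cons (f x) x} := by
  set θ : Fin (m + 1) → Fin (m + 1) := Fin.snoc (fun i : Fin m => i.succ) 0 with hθ
  convert Literature.ModelTheory.ExponentialFields.IsSemialgebraic.preimage_comp θ hf using 1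
  ext z
  simp only [mem_setOf_eq, mem_preimage]
  constructor
  · rintro ⟨x, hx, rfl⟩
    refine ⟨x, hx, ?_⟩
    funext i
    refine Fin.lastCases ?_ (fun j => ?_) i
    · simp [hθ]
    · simp [hθ]
  · rintro ⟨x, hx, h⟩
    refine ⟨x, hx, ?_⟩
    funext i
    refine Fin.cases ?_ (fun j => ?_) i
    · have := congr_fun h (Fin.last m)
      simpa [hθ] using this
    · have := congr_fun h (Fin.castSucc j)
      simpa [hθ] using this

/-- **A semialgebraic function satisfies a non-trivial algebraic relation.** There is a finite
family `Q₀` of polynomials over `k` in `(y, x)`, none vanishing identically on `ℝ ^ (1 + m)`, such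
that every point `(f x, x)`, `x ∈ s`, of the graph is a zero of some member of `Q₀`: the graph is
contained in its interior together with such zero sets
(`IsSemialgebraic.subset_interior_union`), and the interior of a graph is empty.
[cite: BochnakCosteRoy1998, §2.9 (Prop. 2.9.10, proof: `P(x, f(x)) = 0`)] -/
theorem IsSemialgebraicFunOn.exists_finset_forall_exists_aeval_cons_eq_zero
    (hf : IsSemialgebraicFunOn k s f) :
    ∃ Q₀ : Finset (MvPolynomial (Fin (m + 1)) k),
      (∀ q ∈ Q₀, ∃ w : Fin (m + 1) → ℝ, aeval w q ≠ 0) ∧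
      ∀ x ∈ s, ∃ q ∈ Q₀, aeval (Fin.cons (f x) x : Fin (m + 1) → ℝ) q = 0 := by
  obtain ⟨Q₀, hQ₀, hsub⟩ := hf.isSemialgebraic_setOf_cons.subset_interior_union
  refine ⟨Q₀, hQ₀, fun x hx => ?_⟩
  have hz : (Fin.cons (f x) x : Fin (m + 1) → ℝ) ∈
      {z : Fin (m + 1) → ℝ | ∃ x ∈ s, z = Fin.cons (f x) x} := ⟨x, hx, rfl⟩
  rcases hsub hz with hint | hZ
  · -- the interior of a graph is empty
    exfalso
    obtain ⟨ε, hε, hball⟩ := Metric.mem_nhds_iff.mp (mem_interior_iff_mem_nhds.mp hint)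
    have hmem : (Fin.cons (f x + ε / 2) x : Fin (m + 1) → ℝ) ∈
        Metric.ball (Fin.cons (f x) x : Fin (m + 1) → ℝ) ε := by
      rw [Metric.mem_ball, dist_pi_lt_iff hε]
      intro i
      refine Fin.cases ?_ (fun j => ?_) i
      · simp only [Fin.cons_zero, Real.dist_eq, add_sub_cancel_left]
        rw [abs_of_pos (half_pos hε)]
        exact half_lt_self hε
      · simp [hε]
    obtain ⟨x', -, h⟩ := hball hmem
    have h0 := congr_fun h 0
    have htail : x = x' := funext fun j => by simpa using congr_fun h j.succ
    simp only [Fin.cons_zero] at h0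
    rw [← htail] at h0
    linarith
  · simp only [mem_iUnion, mem_setOf_eq, exists_prop] at hZ
    exact hZ

/-- Graph elimination in `cons` form with an extra condition on `x`: for semialgebraic
`V ⊆ ℝ ^ m` and `T ⊆ ℝ ^ (1 + m)`, the set `{x ∈ s | x ∈ V ∧ (f x, x) ∈ T}` is semialgebraic
(Tarski–Seidenberg). [cite: BochnakCosteRoy1998, Thm. 2.2.1] -/
theorem IsSemialgebraicFunOn.isSemialgebraic_sep_cons_mem (hf : IsSemialgebraicFunOn k s f)
    {V : Set (Fin m → ℝ)} (hV : Literature.ModelTheory.ExponentialFields.IsSemialgebraic k V)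
    {T : Set (Fin (m + 1) → ℝ)} (hT : Literature.ModelTheory.ExponentialFields.IsSemialgebraic k T) :
    Literature.ModelTheory.ExponentialFields.IsSemialgebraic k
      {x | x ∈ s ∧ x ∈ V ∧ (Fin.cons (f x) x : Fin (m + 1) → ℝ) ∈ T} := by
  set θ : Fin (m + 1) → Fin (m + 1) := Fin.cons (Fin.last m) Fin.castSucc with hθ
  have hT' : Literature.ModelTheory.ExponentialFields.IsSemialgebraic k
      (((fun z : Fin (m + 1) → ℝ => z ∘ θ) ⁻¹' T) ∩ {z : Fin (m + 1) → ℝ | Fin.init z ∈ V}) :=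
    (hT.preimage_comp θ).inter hV.setOf_init_mem
  convert hf.isSemialgebraic_sep_snoc_mem
    Literature.ModelTheory.ExponentialFields.tarski_seidenberg_real_holds hT' using 1
  ext x
  have hcons : (Fin.snoc x (f x) : Fin (m + 1) → ℝ) ∘ θ = Fin.cons (f x) x := by
    funext i
    refine Fin.cases ?_ (fun j => ?_) i
    · simp [hθ]
    · simp [hθ]
  simp only [mem_setOf_eq, mem_inter_iff, mem_preimage, Fin.init_snoc, hcons]
  tauto

/-- The pieces `M(q, e, τ) = {x ∈ s | deg q(x, ·) = e, sign ∂ʲq(x, ·)(f x) = τ j ∀ j ≤ N}` are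
semialgebraic (graph elimination). [cite: BochnakCosteRoy1998, Thm. 2.2.1] -/
theorem IsSemialgebraicFunOn.isSemialgebraic_piece (hf : IsSemialgebraicFunOn k s f)
    (q : MvPolynomial (Fin (m + 1)) k) (N : ℕ) (e : Fin (N + 1)) (τ : Fin (N + 1) → SignType) :
    Literature.ModelTheory.ExponentialFields.IsSemialgebraic k
      {x | x ∈ s ∧
        (aeval x ((finSuccEquiv k m q).coeff e) ≠ 0 ∧
          ∀ j : Fin (N + 1), (e : ℕ) < j → aeval x ((finSuccEquiv k m q).coeff j) = 0) ∧
        ∀ j : Fin (N + 1), SignType.sign (aeval (Fin.cons (f x) x : Fin (m + 1) → ℝ)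
          ((finSuccEquiv k m).symm (derivative^[(j : ℕ)] (finSuccEquiv k m q)))) = τ j} := by
  have hV : Literature.ModelTheory.ExponentialFields.IsSemialgebraic k
      {x : Fin m → ℝ | aeval x ((finSuccEquiv k m q).coeff e) ≠ 0 ∧
        ∀ j : Fin (N + 1), (e : ℕ) < j → aeval x ((finSuccEquiv k m q).coeff j) = 0} := by
    have h1 := Literature.ModelTheory.ExponentialFields.isSemialgebraic_setOf_eval_ne_zero
      (k := k) (R := ℝ) ((finSuccEquiv k m q).coeff e)
    have h2 : Literature.ModelTheory.ExponentialFields.IsSemialgebraic k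
        (⋂ j ∈ (Finset.univ.filter fun j : Fin (N + 1) => (e : ℕ) < j),
          {x : Fin m → ℝ | aeval x ((finSuccEquiv k m q).coeff j) = 0}) :=
      Literature.ModelTheory.ExponentialFields.IsSemialgebraic.biInter _ _ fun j _ =>
        Literature.ModelTheory.ExponentialFields.isSemialgebraic_setOf_eval_eq_zero _
    convert h1.inter h2 using 1
    ext x
    simp only [mem_setOf_eq, mem_inter_iff, mem_iInter, Finset.mem_filter, Finset.mem_univ,
      true_and]
  have hT : Literature.ModelTheory.ExponentialFields.IsSemialgebraic k
      {w : Fin (m + 1) → ℝ | ∀ j : Fin (N + 1), SignType.sign (aeval w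
        ((finSuccEquiv k m).symm (derivative^[(j : ℕ)] (finSuccEquiv k m q)))) = τ j} := by
    have := Literature.ModelTheory.ExponentialFields.IsSemialgebraic.biInter
      (Finset.univ : Finset (Fin (N + 1))) _ fun j _ =>
        Literature.ModelTheory.ExponentialFields.isSemialgebraic_setOf_sign_aeval_eq (k := k)
          ((finSuccEquiv k m).symm (derivative^[(j : ℕ)] (finSuccEquiv k m q))) (τ j)
    convert this using 1
    ext w
    simp
  exact hf.isSemialgebraic_sep_cons_mem hV hT

end Graph

/-! ### Smoothness on the interior of a piece -/

section Piece

variable {f : (Fin m → ℝ) → ℝ}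

/-- **`f` is `C^∞` on the interior of each piece.** On the interior `U` of
`{x | deg q(x, ·) = e ∧ ∀ j ≤ N, sign ∂ʲq(x, ·)(f x) = τ j}` with `τ 0 = 0`, the function `f` is
continuous (`continuousAt_of_thom_signs`) and `f x` is a simple root of `∂ʳ⁻¹q(x, ·)` for the least
`r ≥ 1` with `τ r ≠ 0`, hence `f` is `C^∞` (`contDiffAt_of_simple_root`).
[cite: BochnakCosteRoy1998, §2.9 (Prop. 2.9.10)] -/
theorem contDiffAt_of_mem_interior_piece (q : MvPolynomial (Fin (m + 1)) k) {N : ℕ}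
    (hN : (finSuccEquiv k m q).natDegree ≤ N) (e : Fin (N + 1)) {τ : Fin (N + 1) → SignType}
    (hτ : τ 0 = 0) {x₀ : Fin m → ℝ}
    (hx₀ : x₀ ∈ interior {x : Fin m → ℝ |
      (aeval x ((finSuccEquiv k m q).coeff e) ≠ 0 ∧
          ∀ j : Fin (N + 1), (e : ℕ) < j → aeval x ((finSuccEquiv k m q).coeff j) = 0) ∧
        ∀ j : Fin (N + 1), SignType.sign (aeval (Fin.cons (f x) x : Fin (m + 1) → ℝ)
          ((finSuccEquiv k m).symm (derivative^[(j : ℕ)] (finSuccEquiv k m q)))) = τ j}) :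
    ContDiffAt ℝ ∞ f x₀ := by
  -- the open set `U` and the specialisations `P x = q(x, ·)`
  set U := interior {x : Fin m → ℝ |
      (aeval x ((finSuccEquiv k m q).coeff e) ≠ 0 ∧
          ∀ j : Fin (N + 1), (e : ℕ) < j → aeval x ((finSuccEquiv k m q).coeff j) = 0) ∧
        ∀ j : Fin (N + 1), SignType.sign (aeval (Fin.cons (f x) x : Fin (m + 1) → ℝ)
          ((finSuccEquiv k m).symm (derivative^[(j : ℕ)] (finSuccEquiv k m q)))) = τ j} with hU
  have hUo : IsOpen U := isOpen_interior
  set P : (Fin m → ℝ) → ℝ[X] := fun x =>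
    (finSuccEquiv k m q).map (MvPolynomial.eval₂Hom (algebraMap k ℝ) x) with hP
  have hcoefP : ∀ x i, (P x).coeff i = aeval x ((finSuccEquiv k m q).coeff i) := fun x i =>
    coeff_map_finSuccEquiv q x i
  have hmem : ∀ x ∈ U, x ∈ {x : Fin m → ℝ |
      (aeval x ((finSuccEquiv k m q).coeff e) ≠ 0 ∧
          ∀ j : Fin (N + 1), (e : ℕ) < j → aeval x ((finSuccEquiv k m q).coeff j) = 0) ∧
        ∀ j : Fin (N + 1), SignType.sign (aeval (Fin.cons (f x) x : Fin (m + 1) → ℝ)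
          ((finSuccEquiv k m).symm (derivative^[(j : ℕ)] (finSuccEquiv k m q)))) = τ j} :=
    fun x hx => interior_subset hx
  -- degree exactly `e`, non-vanishing
  have he : ∀ x ∈ U, (P x).natDegree = e := by
    intro x hx
    refine natDegree_eq_of_le_of_coeff_ne_zero (natDegree_le_iff_coeff_eq_zero.mpr fun j hj => ?_)
      (by rw [hcoefP]; exact (hmem x hx).1.1)
    by_cases hjN : j < N + 1
    · rw [hcoefP]
      exact (hmem x hx).1.2 ⟨j, hjN⟩ hj
    · exact coeff_eq_zero_of_natDegree_lt
        ((natDegree_map_le.trans hN).trans_lt (not_lt.mp hjN))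
  have hP0 : ∀ x ∈ U, P x ≠ 0 := by
    intro x hx h0
    have := (hmem x hx).1.1
    rw [← hcoefP, h0, Polynomial.coeff_zero] at this
    exact this rfl
  -- the Thom sign vector, extended by `0`
  set σ : ℕ → SignType := fun j => if h : j < N + 1 then τ ⟨j, h⟩ else 0 with hσ
  have hσ0 : σ 0 = 0 := by simp [hσ, hτ]
  have hsign : ∀ x ∈ U, ∀ j ≤ (e : ℕ),
      SignType.sign ((derivative^[j] (P x)).eval (f x)) = σ j := by
    intro x hx j hj
    have hjN : j < N + 1 := lt_of_le_of_lt hj e.2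
    have := (hmem x hx).2 ⟨j, hjN⟩
    rw [aeval_cons_symm_iterate_derivative] at this
    have hσj : σ j = τ ⟨j, hjN⟩ := dif_pos hjN
    rw [hσj, ← this]
  -- continuity on `U`
  have hcont : ∀ x ∈ U, ContinuousAt f x := fun x hx =>
    continuousAt_of_thom_signs hUo P (continuous_eval_iterate_derivative_map q)
      (continuous_coeff_map_finSuccEquiv q) he hP0 hσ0 hsign hx
  -- the least `r ≥ 1` with `σ r ≠ 0`
  have hex : ∃ j, 1 ≤ j ∧ j ≤ (e : ℕ) ∧ σ j ≠ 0 := by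
    have htop : SignType.sign ((derivative^[(e : ℕ)] (P x₀)).eval (f x₀)) ≠ 0 := by
      rw [eval_iterate_derivative_natDegree (he x₀ hx₀), Ne, sign_eq_zero_iff, mul_eq_zero,
        not_or]
      exact ⟨Nat.cast_ne_zero.mpr (Nat.factorial_ne_zero _),
        by rw [hcoefP]; exact (hmem x₀ hx₀).1.1⟩
    rw [hsign x₀ hx₀ e le_rfl] at htop
    refine ⟨e, Nat.one_le_iff_ne_zero.mpr fun h0 => ?_, le_rfl, htop⟩
    rw [h0, hσ0] at htop
    exact htop rfl
  classical
  obtain ⟨hr1, hre, hσr⟩ := Nat.find_spec hex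
  have hmin : ∀ j < Nat.find hex, ¬(1 ≤ j ∧ j ≤ (e : ℕ) ∧ σ j ≠ 0) := fun j hj => Nat.find_min hex hj
  set r := Nat.find hex with hr
  have hσr1 : σ (r - 1) = 0 := by
    by_cases h1 : r = 1
    · rw [h1, Nat.sub_self, hσ0]
    · by_contra hne
      exact hmin (r - 1) (by omega) ⟨by omega, by omega, hne⟩
  -- `f x` is a simple root of `∂ʳ⁻¹q(x, ·)` on `U`
  set F : (Fin m → ℝ) × ℝ → ℝ := fun z => aeval (Fin.cons z.2 z.1 : Fin (m + 1) → ℝ)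
    ((finSuccEquiv k m).symm (derivative^[r - 1] (finSuccEquiv k m q))) with hF
  have hFs : ContDiff ℝ ∞ F := contDiff_aeval_cons _
  have hroot : ∀ x ∈ U, F (x, f x) = 0 := by
    intro x hx
    have := hsign x hx (r - 1) (by omega)
    rw [hσr1, sign_eq_zero_iff] at this
    simpa only [hF, aeval_cons_symm_iterate_derivative] using this
  have hder : ∀ x ∈ U, deriv (fun y => F (x, y)) (f x) ≠ 0 := by
    intro x hx
    have := hsign x hx r hre
    have hr' : r - 1 + 1 = r := by omega
    simp only [hF]
    rw [deriv_aeval_cons_symm_iterate_derivative, hr']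
    intro h0
    rw [h0, sign_zero] at this
    exact hσr this.symm
  exact contDiffAt_of_simple_root hUo F hFs hroot hder hcont hx₀

end Piece

/-! ### Assembly -/

section Assembly

namespace IsSemialgebraicFunOn

variable {s : Set (Fin m → ℝ)} {f : (Fin m → ℝ) → ℝ}

/-- **Discharge of the named fact `IsSemialgebraicFunOn.exists_contDiffOn`.** A real function with
`k`-semialgebraic graph over `s ⊆ ℝ ^ m` is `C^∞` off a `k`-semialgebraic subset `Z ⊆ s` with empty
interior, `s \ Z` being open: `s \ Z` is the union of the interiors of the finitely many pieces
`M(q, e, τ)` (on which `f` is a Thom-selected simple root of `∂ʳ⁻¹q(x, ·)`, continuous by Thom's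
lemma and smooth by the implicit function theorem), and `Z` is covered by the proper algebraic sets
`{x | q(x, ·) = 0}` and the nowhere dense semialgebraic sets `M \ interior M`.
[cite: BochnakCosteRoy1998, §2.9 (Prop. 2.9.10 with the stratification Thm. 9.1.8)] -/
theorem exists_contDiffOn_holds : exists_contDiffOn (k := k) (s := s) (f := f) := by
  intro _ hf
  classical
  obtain ⟨Q₀, hQ₀, hvan⟩ := hf.exists_finset_forall_exists_aeval_cons_eq_zero
  -- a uniform bound on the `y`-degrees
  set N : ℕ := Q₀.sup fun q => (finSuccEquiv k m q).natDegree with hN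
  have hNq : ∀ q ∈ Q₀, (finSuccEquiv k m q).natDegree ≤ N := fun q hq =>
    Finset.le_sup (f := fun q => (finSuccEquiv k m q).natDegree) hq
  -- the pieces and their index set
  set M : MvPolynomial (Fin (m + 1)) k × Fin (N + 1) × (Fin (N + 1) → SignType) →
      Set (Fin m → ℝ) := fun i =>
    {x | x ∈ s ∧
      (aeval x ((finSuccEquiv k m i.1).coeff i.2.1) ≠ 0 ∧
          ∀ j : Fin (N + 1), (i.2.1 : ℕ) < j → aeval x ((finSuccEquiv k m i.1).coeff j) = 0) ∧
        ∀ j : Fin (N + 1), SignType.sign (aeval (Fin.cons (f x) x : Fin (m + 1) → ℝ)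
          ((finSuccEquiv k m).symm (derivative^[(j : ℕ)] (finSuccEquiv k m i.1)))) = i.2.2 j}
    with hM
  set I : Finset (MvPolynomial (Fin (m + 1)) k × Fin (N + 1) × (Fin (N + 1) → SignType)) :=
    Q₀ ×ˢ ((Finset.univ : Finset (Fin (N + 1))) ×ˢ
      (Finset.univ.filter fun τ : Fin (N + 1) → SignType => τ 0 = 0)) with hI
  have hMs : ∀ i, M i ⊆ s := fun i x hx => hx.1
  have hMsa : ∀ i, Literature.ModelTheory.ExponentialFields.IsSemialgebraic k (M i) := fun i =>
    hf.isSemialgebraic_piece i.1 N i.2.1 i.2.2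
  have hGs : (⋃ i ∈ I, interior (M i)) ⊆ s :=
    iUnion₂_subset fun i _ => interior_subset.trans (hMs i)
  refine ⟨s \ ⋃ i ∈ I, interior (M i), Set.sdiff_subset, ?_, ?_, ?_, ?_⟩
  · -- `Z` is semialgebraic
    exact (isSemialgebraic_holds hf).diff
      (Literature.ModelTheory.ExponentialFields.IsSemialgebraic.biUnion I (fun i => interior (M i))
        fun i _ => Literature.ModelTheory.ExponentialFields.isSemialgebraic_interior (hMsa i))
  · -- `Z` has empty interior: it is covered by finitely many closed sets with empty interior
    -- (a) the proper algebraic sets `W q = {x | q(x, ·) = 0}`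
    have hW : ∀ q ∈ Q₀,
        IsClosed {x : Fin m → ℝ | ∀ i ≤ N, aeval x ((finSuccEquiv k m q).coeff i) = 0} ∧
        interior {x : Fin m → ℝ | ∀ i ≤ N, aeval x ((finSuccEquiv k m q).coeff i) = 0} = ∅ := by
      intro q hq
      obtain ⟨w, hw⟩ := hQ₀ q hq
      have hPw : (finSuccEquiv k m q).map (MvPolynomial.eval₂Hom (algebraMap k ℝ) (Fin.tail w)) ≠
          0 := by
        intro h0
        apply hw
        rw [← Fin.cons_self_tail w, aeval_cons_eq_eval_map, h0, Polynomial.eval_zero]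
      obtain ⟨i₀, hi₀, hne⟩ : ∃ i ≤ N, aeval (Fin.tail w) ((finSuccEquiv k m q).coeff i) ≠ 0 := by
        by_contra hall
        push Not at hall
        exact hPw ((map_finSuccEquiv_eq_zero_iff q _ (hNq q hq)).mpr hall)
      have hrepr : {x : Fin m → ℝ | ∀ i ≤ N, aeval x ((finSuccEquiv k m q).coeff i) = 0} =
          ⋂ i ∈ Finset.range (N + 1), {x : Fin m → ℝ | aeval x ((finSuccEquiv k m q).coeff i) = 0} := by
        ext x
        simp only [mem_setOf_eq, mem_iInter, Finset.mem_range, Nat.lt_succ_iff]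
      refine ⟨?_, ?_⟩
      · rw [hrepr]
        exact isClosed_biInter fun i _ =>
          Literature.ModelTheory.ExponentialFields.isClosed_setOf_aeval_eq_zero _
      · refine subset_empty_iff.mp ((interior_mono fun x hx => ?_).trans
          (Literature.ModelTheory.ExponentialFields.interior_setOf_aeval_eq_zero
            ((finSuccEquiv k m q).coeff i₀) ⟨_, hne⟩).subset)
        exact hx i₀ hi₀
    have hF₁c : IsClosed (⋃ q ∈ Q₀,
        {x : Fin m → ℝ | ∀ i ≤ N, aeval x ((finSuccEquiv k m q).coeff i) = 0}) :=
      isClosed_biUnion_finset fun q hq => (hW q hq).1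
    have hF₁i : interior (⋃ q ∈ Q₀,
        {x : Fin m → ℝ | ∀ i ≤ N, aeval x ((finSuccEquiv k m q).coeff i) = 0}) = ∅ :=
      Literature.ModelTheory.ExponentialFields.interior_biUnion_finset_eq_empty Q₀ _
        (fun q hq => (hW q hq).1) fun q hq => (hW q hq).2
    -- (b) the nowhere dense sets `M i \ interior (M i)`
    have hF₂i : interior (⋃ i ∈ I, closure (M i \ interior (M i))) = ∅ :=
      Literature.ModelTheory.ExponentialFields.interior_biUnion_finset_eq_empty I _
        (fun i _ => isClosed_closure) fun i _ =>
          (Literature.ModelTheory.ExponentialFields.isSemialgebraic_diff_interior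
            (hMsa i)).1.interior_closure_eq_empty
            (Literature.ModelTheory.ExponentialFields.isSemialgebraic_diff_interior (hMsa i)).2
    -- the cover
    have hcover : s \ (⋃ i ∈ I, interior (M i)) ⊆
        (⋃ q ∈ Q₀, {x : Fin m → ℝ | ∀ i ≤ N, aeval x ((finSuccEquiv k m q).coeff i) = 0}) ∪
          ⋃ i ∈ I, closure (M i \ interior (M i)) := by
      rintro x ⟨hxs, hxG⟩
      obtain ⟨q, hq, hq0⟩ := hvan x hxs
      by_cases hPx : (finSuccEquiv k m q).map (MvPolynomial.eval₂Hom (algebraMap k ℝ) x) = 0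
      · exact Or.inl (mem_iUnion₂.mpr ⟨q, hq, (map_finSuccEquiv_eq_zero_iff q x (hNq q hq)).mp hPx⟩)
      · right
        set Px := (finSuccEquiv k m q).map (MvPolynomial.eval₂Hom (algebraMap k ℝ) x) with hPx'
        have heN : Px.natDegree < N + 1 :=
          Nat.lt_succ_of_le (natDegree_map_le.trans (hNq q hq))
        set e : Fin (N + 1) := ⟨Px.natDegree, heN⟩ with he
        set τ : Fin (N + 1) → SignType := fun j => SignType.sign
          (aeval (Fin.cons (f x) x : Fin (m + 1) → ℝ)
            ((finSuccEquiv k m).symm (derivative^[(j : ℕ)] (finSuccEquiv k m q)))) with hτ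
        have hτ0 : τ 0 = 0 := by
          simp [hτ, hq0]
        have hiI : (q, e, τ) ∈ I := by
          simp [hI, hq, hτ0]
        have hxM : x ∈ M (q, e, τ) := by
          refine ⟨hxs, ⟨?_, fun j hj => ?_⟩, fun j => rfl⟩
          · rw [← coeff_map_finSuccEquiv]
            exact leadingCoeff_ne_zero.mpr hPx
          · rw [← coeff_map_finSuccEquiv]
            exact coeff_eq_zero_of_natDegree_lt hj
        have hxnot : x ∉ interior (M (q, e, τ)) := fun h => hxG (mem_iUnion₂.mpr ⟨(q, e, τ), hiI, h⟩)
        exact mem_iUnion₂.mpr ⟨(q, e, τ), hiI, subset_closure ⟨hxM, hxnot⟩⟩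
    have hunion : interior
        ((⋃ q ∈ Q₀, {x : Fin m → ℝ | ∀ i ≤ N, aeval x ((finSuccEquiv k m q).coeff i) = 0}) ∪
          ⋃ i ∈ I, closure (M i \ interior (M i))) = ∅ := by
      rw [interior_union_isClosed_of_interior_empty hF₁c hF₂i, hF₁i]
    exact subset_empty_iff.mp ((interior_mono hcover).trans hunion.subset)
  · -- `s \ Z` is open
    rw [Set.sdiff_sdiff_cancel_left hGs]
    exact isOpen_biUnion fun i _ => isOpen_interior
  · -- `f` is `C^∞` on `s \ Z`
    rw [Set.sdiff_sdiff_cancel_left hGs]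
    intro x hx
    obtain ⟨i, hi, hxi⟩ := mem_iUnion₂.mp hx
    have hi' : i.1 ∈ Q₀ ∧ i.2.2 0 = 0 := by
      simpa [hI] using hi
    refine (contDiffAt_of_mem_interior_piece i.1 (hNq i.1 hi'.1) i.2.1 hi'.2
      (interior_mono (fun y hy => hy.2) hxi)).contDiffWithinAt

end IsSemialgebraicFunOn

end Assembly

end Literature.NumberTheory.Transcendental
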